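import Mathlib
import Summits.NavierStokesRegularity.NavierStokesRegularity.Theorems.EulerZoomLiouvillePowerGaugeEulerLiouvilleSelfSimilarEndpointMember
import Summits.NavierStokesRegularity.NavierStokesRegularity.Theorems.EulerZoomLiouvillePowerGaugeEulerLiouvilleSelfSimilarEndpointProfilePoisson
import Summits.NavierStokesRegularity.NavierStokesRegularity.Theorems.EulerZoomLiouvillePowerGaugeEulerLiouvilleSelfSimilarEndpointPressureIdentification
import HarnessLib

/-!
# Rung C1 of the crux `EulerZoomLiouville.PowerGaugeEulerLiouville` at the endpoint `ρ = 1/2`: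
# the power-spread stratum with the Riesz representation DERIVED from the class

Route №10 `EulerZoomLiouville` (NavierStokesRegularity), crux E = stmt-NavierStokesRegularity-19832,
rung C1 at the energy-conserving endpoint.  `…SelfSimilarEndpointMember` excluded exactly
self-similar members with Chae–Shvydkoy's power spread ASSUMING that the pressure profile is the
(scale-wise) Riesz pressure of the velocity profile — Chae–Shvydkoy's standing assumption "the
pressure `q` given by (2.3)".  In Seregin's class this is a THEOREM: the profile solves the weak
Poisson equation (`profile_pressure_poisson`), the `D`-gauge makes `∫_{B_L} |P|` grow like
`L^{5/3}`, the sublinear bound makes `∫_{B_L} |V|³` grow like `L^{1−δ}`, and the identification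
`pressure_ae_eq_scaleQ_of_poisson` applies.  Hence:

* `selfSimilar_half_false_of_powerSpread'` — an exactly self-similar member of E's class at
  `ρ = 1/2` whose profile has the power spread `c₀|y|^{−(4−δ')} ≤ ‖V(y)‖ ≤ C_up|y|^{1−δ}` a.e. far
  out does not exist: EXACTLY Chae–Shvydkoy's Thm 3.1 hypotheses (minus `C¹_loc`, minus the
  explicit pressure formula), inside the suitable weak class;
* `selfSimilar_half_ae_eq_zero_of_powerSpread'` — the `Sig.rungC1_selfSimilar`-shaped form.

WHAT THIS IS NOT: not NS, not E, not rung C1 — the endpoint without a LOWER power bound stays the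
open Chae–Shvydkoy endpoint.
-/

noncomputable section

-- flat `Theorems/<Route><Decl>…` files of one crux share the namespace of the crux (tree convention)
set_option linter.dupNamespace false

open MeasureTheory Set Filter Topology Metric Function TopologicalSpace
open scoped ENNReal NNReal InnerProductSpace RealInnerProductSpace Laplacian

namespace Summit.NavierStokesRegularity.NavierStokesRegularity.Theorems.PowerGaugeEulerLiouville

open Literature.Analysis Literature.Analysis.FunctionSpaces Literature.Analysis.FluidPDE

section Growth

variable {V : EuclideanSpace ℝ (Fin 3) → EuclideanSpace ℝ (Fin 3)} {P : EuclideanSpace ℝ (Fin 3) → ℝ}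

/-- **The weighted `D`-gauge bound localised to balls:** `∫_{B_L} |P|^{3/2} ≤ L · B` (in `ℝ≥0∞`)
when `∫ |P|^{3/2} |y|^{−1} ≤ B`. [folklore] -/
theorem lintegral_ball_rpow_le_of_weight {B : ℝ≥0∞}
    (hPw : ∫⁻ y, ‖P y‖ₑ ^ (3 / 2 : ℝ) * ENNReal.ofReal (‖y‖ ^ (2 * (1 / 2 : ℝ) - 2)) ≤ B)
    {L : ℝ} (hL : 0 < L) :
    ∫⁻ y in ball (0 : EuclideanSpace ℝ (Fin 3)) L, ‖P y‖ₑ ^ (3 / 2 : ℝ) ≤ ENNReal.ofReal L * B := by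
  have h0 : ∀ᵐ y ∂(volume.restrict (ball (0 : EuclideanSpace ℝ (Fin 3)) L)),
      y ≠ (0 : EuclideanSpace ℝ (Fin 3)) := by
    refine ae_restrict_of_ae ?_
    rw [ae_iff]; simp only [ne_eq, not_not, setOf_eq_eq_singleton, measure_singleton]
  calc ∫⁻ y in ball (0 : EuclideanSpace ℝ (Fin 3)) L, ‖P y‖ₑ ^ (3 / 2 : ℝ)
      ≤ ∫⁻ y in ball (0 : EuclideanSpace ℝ (Fin 3)) L, ENNReal.ofReal L *
          (‖P y‖ₑ ^ (3 / 2 : ℝ) * ENNReal.ofReal (‖y‖ ^ (2 * (1 / 2 : ℝ) - 2))) := by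
        refine lintegral_mono_ae ?_
        filter_upwards [h0, ae_restrict_mem measurableSet_ball] with y hy0 hyL
        rw [mem_ball, dist_zero_right] at hyL
        have hy : 0 < ‖y‖ := norm_pos_iff.2 hy0
        have hw : (1 : ℝ≥0∞) ≤ ENNReal.ofReal L * ENNReal.ofReal (‖y‖ ^ (2 * (1 / 2 : ℝ) - 2)) := by
          rw [← ENNReal.ofReal_mul hL.le, ← ENNReal.ofReal_one]
          refine ENNReal.ofReal_le_ofReal ?_
          norm_num
          rw [Real.rpow_neg_one, ← div_eq_mul_inv, le_div_iff₀ hy, one_mul]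
          exact hyL.le
        calc ‖P y‖ₑ ^ (3 / 2 : ℝ) = ‖P y‖ₑ ^ (3 / 2 : ℝ) * 1 := (mul_one _).symm
          _ ≤ ‖P y‖ₑ ^ (3 / 2 : ℝ) * (ENNReal.ofReal L * ENNReal.ofReal (‖y‖ ^ (2 * (1 / 2 : ℝ) - 2))) := by
              gcongr
          _ = _ := by ring
    _ = ENNReal.ofReal L * ∫⁻ y in ball (0 : EuclideanSpace ℝ (Fin 3)) L,
          ‖P y‖ₑ ^ (3 / 2 : ℝ) * ENNReal.ofReal (‖y‖ ^ (2 * (1 / 2 : ℝ) - 2)) := by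
        rw [lintegral_const_mul' _ _ ENNReal.ofReal_ne_top]
    _ ≤ ENNReal.ofReal L * B := by
        gcongr; exact (setLIntegral_le_lintegral _ _).trans hPw

/-- **`P ∈ L^{3/2}(B_L)` from the weighted bound.** [folklore] -/
theorem memLp_threeHalves_ball_of_weight (hPm : AEStronglyMeasurable P volume) {B : ℝ≥0∞}
    (hB : B ≠ ⊤)
    (hPw : ∫⁻ y, ‖P y‖ₑ ^ (3 / 2 : ℝ) * ENNReal.ofReal (‖y‖ ^ (2 * (1 / 2 : ℝ) - 2)) ≤ B)
    {L : ℝ} (hL : 0 < L) :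
    MemLp P (3 / 2 : ℝ≥0∞) (volume.restrict (ball (0 : EuclideanSpace ℝ (Fin 3)) L)) := by
  refine ⟨hPm.restrict, ?_⟩
  rw [eLpNorm_eq_lintegral_rpow_enorm_toReal (by simp) (ENNReal.div_ne_top (by norm_num) (by norm_num))]
  have htR : (3 / 2 : ℝ≥0∞).toReal = 3 / 2 := by norm_num
  rw [htR]
  refine ENNReal.rpow_lt_top_of_nonneg (by norm_num) (ne_of_lt ?_)
  exact lt_of_le_of_lt (lintegral_ball_rpow_le_of_weight hPw hL)
    (ENNReal.mul_lt_top ENNReal.ofReal_lt_top hB.lt_top)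

/-- **Growth of `∫_{B_L} |P|`** from the weighted `D`-gauge bound: `≤ B^{2/3} (vol B₁)^{1/3} L^{5/3}`
for `L ≥ 1` (Hölder `(3/2, 3)` on `B_L`). [folklore] -/
theorem setIntegral_abs_le_of_weight (hPm : AEStronglyMeasurable P volume) {B : ℝ≥0∞} (hB : B ≠ ⊤)
    (hPw : ∫⁻ y, ‖P y‖ₑ ^ (3 / 2 : ℝ) * ENNReal.ofReal (‖y‖ ^ (2 * (1 / 2 : ℝ) - 2)) ≤ B)
    {L : ℝ} (hL : 1 ≤ L) :
    ∫ y in ball (0 : EuclideanSpace ℝ (Fin 3)) L, |P y| ≤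
      B.toReal ^ (2 / 3 : ℝ) * (volume.real (ball (0 : EuclideanSpace ℝ (Fin 3)) 1)) ^ (1 / 3 : ℝ) *
        L ^ (5 / 3 : ℝ) := by
  have hL0 : 0 < L := by linarith
  set D : Set (EuclideanSpace ℝ (Fin 3)) := ball 0 L with hD
  haveI : IsFiniteMeasure (volume.restrict D) := isFiniteMeasure_restrict.2 measure_ball_lt_top.ne
  have hPL := memLp_threeHalves_ball_of_weight hPm hB hPw hL0
  have hpq : Real.HolderConjugate (3 / 2 : ℝ) 3 := by rw [Real.holderConjugate_iff]; norm_num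
  have h32 : ENNReal.ofReal (3 / 2 : ℝ) = (3 / 2 : ℝ≥0∞) := by
    rw [ENNReal.ofReal_div_of_pos (by norm_num)]; simp
  have hf : MemLp (fun y => |P y|) (ENNReal.ofReal (3 / 2 : ℝ)) (volume.restrict D) := by
    rw [h32]; exact hPL.norm
  have hg : MemLp (fun _ : EuclideanSpace ℝ (Fin 3) => (1 : ℝ)) (ENNReal.ofReal 3) (volume.restrict D) :=
    memLp_const 1
  have hH := integral_mul_le_Lp_mul_Lq_of_nonneg hpq (Eventually.of_forall fun y => abs_nonneg (P y))
    (Eventually.of_forall fun _ => zero_le_one) hf hg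
  simp only [mul_one, Real.one_rpow, integral_const, smul_eq_mul, measureReal_restrict_apply_univ] at hH
  -- `∫_D |P|^{3/2} ≤ L · B.toReal`
  have hI : ∫ y in D, |P y| ^ (3 / 2 : ℝ) ≤ L * B.toReal := by
    have hnn : 0 ≤ᵐ[volume.restrict D] fun y => |P y| ^ (3 / 2 : ℝ) :=
      Eventually.of_forall fun y => by positivity
    have hmeas : AEStronglyMeasurable (fun y => |P y| ^ (3 / 2 : ℝ)) (volume.restrict D) :=
      (hPm.restrict.aemeasurable.norm.pow_const (3 / 2 : ℝ)).aestronglyMeasurable.congr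
        (Eventually.of_forall fun y => by simp [Real.norm_eq_abs])
    rw [integral_eq_lintegral_of_nonneg_ae hnn hmeas]
    have e : ∀ y, ENNReal.ofReal (|P y| ^ (3 / 2 : ℝ)) = ‖P y‖ₑ ^ (3 / 2 : ℝ) := fun y => by
      rw [← ENNReal.ofReal_rpow_of_nonneg (abs_nonneg _) (by norm_num), ← Real.enorm_eq_ofReal_abs]
    simp_rw [e]
    have hb := lintegral_ball_rpow_le_of_weight hPw hL0
    rw [← ENNReal.toReal_ofReal hL0.le, ← ENNReal.toReal_mul]
    exact ENNReal.toReal_mono (ENNReal.mul_ne_top ENNReal.ofReal_ne_top hB) hb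
  have hvol : volume.real D = L ^ 3 * volume.real (ball (0 : EuclideanSpace ℝ (Fin 3)) 1) := by
    change (volume (ball (0 : EuclideanSpace ℝ (Fin 3)) L)).toReal =
      L ^ 3 * (volume (ball (0 : EuclideanSpace ℝ (Fin 3)) 1)).toReal
    rw [Measure.addHaar_ball_of_pos volume (0 : EuclideanSpace ℝ (Fin 3)) hL0,
      finrank_euclideanSpace_fin, ENNReal.toReal_mul, ENNReal.toReal_ofReal (by positivity)]
  set v₁ := volume.real (ball (0 : EuclideanSpace ℝ (Fin 3)) 1) with hv₁
  have hv₁0 : 0 ≤ v₁ := measureReal_nonneg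
  have hI0 : 0 ≤ ∫ y in D, |P y| ^ (3 / 2 : ℝ) := setIntegral_nonneg measurableSet_ball fun y _ => by positivity
  calc ∫ y in D, |P y| ≤ (∫ y in D, |P y| ^ (3 / 2 : ℝ)) ^ (1 / (3 / 2 : ℝ)) * (volume.real D) ^ (1 / (3 : ℝ)) := hH
    _ ≤ (L * B.toReal) ^ (2 / 3 : ℝ) * (L ^ 3 * v₁) ^ (1 / 3 : ℝ) := by
        rw [show (1 : ℝ) / (3 / 2) = 2 / 3 by norm_num, hvol]
        gcongr
    _ = B.toReal ^ (2 / 3 : ℝ) * v₁ ^ (1 / 3 : ℝ) * L ^ (5 / 3 : ℝ) := by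
        rw [Real.mul_rpow hL0.le ENNReal.toReal_nonneg, Real.mul_rpow (by positivity) hv₁0,
          ← Real.rpow_natCast L 3, ← Real.rpow_mul hL0.le]
        have e : L ^ (5 / 3 : ℝ) = L ^ (2 / 3 : ℝ) * L ^ ((3 : ℕ) * (1 / 3) : ℝ) := by
          rw [← Real.rpow_add hL0]; norm_num
        rw [e]; push_cast; ring

/-- **Growth of `∫_{B_L} ‖V‖³`** under the sublinear bound: `≤ (K₀ + C_up ‖V‖₂²) L^{5/3}`
for `L ≥ 1`, with `K₀ = ∫_{B̄_{R₀}} ‖V‖³`. [folklore] -/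
theorem setIntegral_cube_le_of_sublinear (hV2 : Integrable (fun z => ‖V z‖ ^ 2) volume)
    (hV3 : LocallyIntegrable (fun y => ‖V y‖ ^ 3) volume)
    {δ Cup R₀ : ℝ} (hδ1 : δ ≤ 1) (hδm : -(2 / 3 : ℝ) ≤ δ) (hCup : 0 ≤ Cup)
    (hup : ∀ᵐ y ∂volume, R₀ ≤ ‖y‖ → ‖V y‖ ≤ Cup * ‖y‖ ^ (1 - δ)) {L : ℝ} (hL : 1 ≤ L) :
    ∫ y in ball (0 : EuclideanSpace ℝ (Fin 3)) L, ‖V y‖ ^ 3 ≤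
      ((∫ y in closedBall (0 : EuclideanSpace ℝ (Fin 3)) |R₀|, ‖V y‖ ^ 3) + Cup * ∫ z, ‖V z‖ ^ 2) *
        L ^ (5 / 3 : ℝ) := by
  have hL0 : 0 < L := by linarith
  set K : Set (EuclideanSpace ℝ (Fin 3)) := closedBall 0 |R₀| with hK
  have hKint : IntegrableOn (fun y => ‖V y‖ ^ 3) K volume := hV3.integrableOn_isCompact (isCompact_closedBall _ _)
  have hK0 : 0 ≤ ∫ y in K, ‖V y‖ ^ 3 := setIntegral_nonneg measurableSet_closedBall fun y _ => by positivity
  have hE0 : 0 ≤ ∫ z, ‖V z‖ ^ 2 := integral_nonneg fun z => by positivity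
  have hBint : IntegrableOn (fun y => ‖V y‖ ^ 3) (ball (0 : EuclideanSpace ℝ (Fin 3)) L) volume :=
    (hV3.integrableOn_isCompact (isCompact_closedBall 0 L)).mono_set ball_subset_closedBall
  -- pointwise: `‖V‖³ ≤ 1_K ‖V‖³ + Cup L^{1−δ} ‖V‖²` on `B_L`
  have hpt : ∀ᵐ y ∂volume, y ∈ ball (0 : EuclideanSpace ℝ (Fin 3)) L →
      ‖V y‖ ^ 3 ≤ K.indicator (fun y => ‖V y‖ ^ 3) y + Cup * L ^ (1 - δ) * ‖V y‖ ^ 2 := by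
    filter_upwards [hup] with y hy hyL
    rw [mem_ball, dist_zero_right] at hyL
    by_cases hyK : y ∈ K
    · rw [indicator_of_mem hyK]
      have : 0 ≤ Cup * L ^ (1 - δ) * ‖V y‖ ^ 2 := by positivity
      linarith
    · rw [indicator_of_notMem hyK, zero_add]
      have hyR : R₀ ≤ ‖y‖ := by
        rw [hK, mem_closedBall, dist_zero_right, not_le] at hyK
        exact (le_abs_self R₀).trans hyK.le
      have h1 : ‖V y‖ ≤ Cup * L ^ (1 - δ) :=
        (hy hyR).trans (mul_le_mul_of_nonneg_left
          (Real.rpow_le_rpow (norm_nonneg _) hyL.le (by linarith)) hCup)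
      calc ‖V y‖ ^ 3 = ‖V y‖ * ‖V y‖ ^ 2 := by ring
        _ ≤ Cup * L ^ (1 - δ) * ‖V y‖ ^ 2 := mul_le_mul_of_nonneg_right h1 (by positivity)
  have hrhs : IntegrableOn (fun y => K.indicator (fun y => ‖V y‖ ^ 3) y + Cup * L ^ (1 - δ) * ‖V y‖ ^ 2)
      (ball (0 : EuclideanSpace ℝ (Fin 3)) L) volume :=
    ((hKint.integrable_indicator measurableSet_closedBall).add (hV2.const_mul _)).integrableOn
  calc ∫ y in ball (0 : EuclideanSpace ℝ (Fin 3)) L, ‖V y‖ ^ 3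
      ≤ ∫ y in ball (0 : EuclideanSpace ℝ (Fin 3)) L,
          (K.indicator (fun y => ‖V y‖ ^ 3) y + Cup * L ^ (1 - δ) * ‖V y‖ ^ 2) :=
        setIntegral_mono_on_ae hBint hrhs measurableSet_ball hpt
    _ = (∫ y in ball (0 : EuclideanSpace ℝ (Fin 3)) L, K.indicator (fun y => ‖V y‖ ^ 3) y) +
          Cup * L ^ (1 - δ) * ∫ y in ball (0 : EuclideanSpace ℝ (Fin 3)) L, ‖V y‖ ^ 2 := by
        rw [integral_add (hKint.integrable_indicator measurableSet_closedBall).integrableOn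
          (hV2.const_mul _).integrableOn, integral_const_mul]
    _ ≤ (∫ y in K, ‖V y‖ ^ 3) + Cup * L ^ (1 - δ) * ∫ z, ‖V z‖ ^ 2 := by
        refine add_le_add ?_ (mul_le_mul_of_nonneg_left ?_ (by positivity))
        · rw [← integral_indicator measurableSet_closedBall]
          exact setIntegral_le_integral (hKint.integrable_indicator measurableSet_closedBall)
            (Eventually.of_forall fun y => indicator_nonneg (fun _ _ => by positivity) _)
        · exact setIntegral_le_integral hV2 (Eventually.of_forall fun y => by positivity)
    _ ≤ ((∫ y in K, ‖V y‖ ^ 3) + Cup * ∫ z, ‖V z‖ ^ 2) * L ^ (5 / 3 : ℝ) := by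
        have h1 : L ^ (1 - δ) ≤ L ^ (5 / 3 : ℝ) := Real.rpow_le_rpow_of_exponent_le hL (by linarith)
        have h2 : (1 : ℝ) ≤ L ^ (5 / 3 : ℝ) := Real.one_le_rpow hL (by norm_num)
        nlinarith [mul_nonneg hCup hE0, hK0]

end Growth

section Member

/-- **Chae–Shvydkoy's Thm 3.1 inside E's class, with the pressure formula derived.**  Let
`(u, p, H, c)` satisfy the three hypotheses of the crux `PowerGaugeEulerLiouville` at `ρ = 1/2`
and be exactly self-similar (`γ = 2/5`).  If the profile has the power spread
`c₀|y|^{−(4−δ')} ≤ ‖V(y)‖ ≤ C_up|y|^{1−δ}` a.e. for large `|y|` (`c₀, δ' > 0`, `−2/3 ≤ δ ≤ 1`),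
contradiction — no hypothesis on the pressure profile is needed: its Riesz representation at
every scale follows from the class (`profile_pressure_poisson`, the `D`-gauge growth `L^{5/3}` of
`∫_{B_L}|P|`, the sublinear growth of `∫_{B_L}|V|³`, `pressure_ae_eq_scaleQ_of_poisson`).
[cite: ChaeShvydkoy2013, §3.1 Thm. 3.1] -/
theorem selfSimilar_half_false_of_powerSpread'
    {u : ℝ → EuclideanSpace ℝ (Fin 3) → EuclideanSpace ℝ (Fin 3)}
    {p : ℝ → EuclideanSpace ℝ (Fin 3) → ℝ}
    {H : ℝ → EuclideanSpace ℝ (Fin 3) → EuclideanSpace ℝ (Fin 3) →L[ℝ] EuclideanSpace ℝ (Fin 3)}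
    {c : ℝ≥0} {V : EuclideanSpace ℝ (Fin 3) → EuclideanSpace ℝ (Fin 3)}
    {P : EuclideanSpace ℝ (Fin 3) → ℝ}
    (hsw : IsSuitableWeakSolutionOn (slab (EuclideanSpace ℝ (Fin 3)) (Iio 0) isOpen_Iio) 0 0 u p)
    (hH : HasWeakSpatialGradientOn (slab (EuclideanSpace ℝ (Fin 3)) (Iio 0) isOpen_Iio) u H)
    (hgauge : ∀ a : ℝ, 0 < a →
      ENNReal.ofReal (a ^ (2 * (1 / 2 : ℝ))) * cknA a (0 : ℝ × EuclideanSpace ℝ (Fin 3)) u +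
          ENNReal.ofReal (a ^ (1 / 2 : ℝ)) * cknE a (0 : ℝ × EuclideanSpace ℝ (Fin 3)) H +
        ENNReal.ofReal (a ^ (2 * (1 / 2 : ℝ))) * cknD a (0 : ℝ × EuclideanSpace ℝ (Fin 3)) p ≤
          (c : ℝ≥0∞))
    (hu : ∀ τ : ℝ, τ < 0 → u τ = selfSimilarCollapse (1 / (2 + (1 / 2 : ℝ))) 0 V τ)
    (hp : ∀ τ : ℝ, τ < 0 → p τ = selfSimilarCollapsePressure (1 / (2 + (1 / 2 : ℝ))) 0 P τ)
    {δ Cup R₀ : ℝ} (hδ : 0 < δ) (hδ1 : δ ≤ 1) (hCup : 0 ≤ Cup)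
    (hup : ∀ᵐ y ∂volume, R₀ ≤ ‖y‖ → ‖V y‖ ≤ Cup * ‖y‖ ^ (1 - δ))
    {c₀ δ' R₀' : ℝ} (hc₀ : 0 < c₀) (hδ' : 0 < δ')
    (hlow : ∀ᵐ y ∂volume, R₀' ≤ ‖y‖ → c₀ * ‖y‖ ^ (-(4 - δ')) ≤ ‖V y‖) : False := by
  have hA : ∀ a : ℝ, 0 < a → ENNReal.ofReal (a ^ (2 * (1 / 2 : ℝ))) *
      cknA a (0 : ℝ × EuclideanSpace ℝ (Fin 3)) u ≤ (c : ℝ≥0∞) :=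
    fun a ha => le_trans (le_trans le_self_add le_self_add) (hgauge a ha)
  have hD : ∀ a : ℝ, 0 < a → ENNReal.ofReal (a ^ (2 * (1 / 2 : ℝ))) *
      cknD a (0 : ℝ × EuclideanSpace ℝ (Fin 3)) p ≤ (c : ℝ≥0∞) :=
    fun a ha => le_trans le_add_self (hgauge a ha)
  have hum : AEStronglyMeasurable (uncurry u)
      (volume.restrict (Iio (0 : ℝ) ×ˢ (univ : Set (EuclideanSpace ℝ (Fin 3))))) := by
    have := hH.locallyIntegrableOn.aestronglyMeasurable
    simpa [slab] using this
  have hpm : AEStronglyMeasurable (uncurry p)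
      (volume.restrict (Iio (0 : ℝ) ×ˢ (univ : Set (EuclideanSpace ℝ (Fin 3))))) := by
    have := hsw.distributional.2.2.1.aestronglyMeasurable
    simpa [slab] using this
  have hVm := aestronglyMeasurable_profile hum hu
  have hPm := aestronglyMeasurable_pressureProfile hpm hp
  have hV2 : Integrable (fun y => ‖V y‖ ^ 2) volume :=
    integrable_norm_sq_of_lintegral_lt_top hVm
      (lt_of_le_of_lt (lintegral_enorm_sq_profile_le_of_half hu hA) ENNReal.coe_lt_top)
  have hV3 : LocallyIntegrable (fun y => ‖V y‖ ^ 3) volume := locallyIntegrable_cube_profile hsw hum hu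
  have hPw := profile_pressure_weight_of_gaugeD (ρ := 1 / 2) (by norm_num) (by norm_num) hpm hp hD
  have hBne : ENNReal.ofReal ((2 - 2 * (1 / 2 : ℝ)) / (2 + 1 / 2)) * (c : ℝ≥0∞) ≠ ⊤ :=
    ENNReal.mul_ne_top ENNReal.ofReal_ne_top ENNReal.coe_ne_top
  -- `P ∈ L¹_loc`
  have hP1 : LocallyIntegrable P volume := by
    rw [locallyIntegrable_iff]
    intro K hK
    obtain ⟨r, hKr⟩ := hK.isBounded.subset_closedBall (0 : EuclideanSpace ℝ (Fin 3))
    have hr : 0 < |r| + 1 := by positivity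
    haveI : IsFiniteMeasure (volume.restrict (ball (0 : EuclideanSpace ℝ (Fin 3)) (|r| + 1))) :=
      isFiniteMeasure_restrict.2 measure_ball_lt_top.ne
    have h32 : (1 : ℝ≥0∞) ≤ 3 / 2 := by
      rw [ENNReal.le_div_iff_mul_le (Or.inl two_ne_zero) (Or.inl ENNReal.ofNat_ne_top)]; norm_num
    have hI : IntegrableOn P (ball (0 : EuclideanSpace ℝ (Fin 3)) (|r| + 1)) volume :=
      (memLp_threeHalves_ball_of_weight hPm hBne hPw hr).integrable h32
    exact hI.mono_set (hKr.trans (closedBall_subset_ball (by linarith [le_abs_self r])))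
  -- the weak Poisson equation of the profile
  have hPoisson := fun (θ : EuclideanSpace ℝ (Fin 3) → ℝ) (hθ : ContDiff ℝ (⊤ : ℕ∞) θ)
      (hθc : HasCompactSupport θ) =>
    profile_pressure_poisson hsw hum hu hp hV2.locallyIntegrable hP1 hθ hθc
  -- growth bounds with `σ = 4/3`
  set AP : ℝ := (ENNReal.ofReal ((2 - 2 * (1 / 2 : ℝ)) / (2 + 1 / 2)) * (c : ℝ≥0∞)).toReal ^ (2 / 3 : ℝ) *
    (volume.real (ball (0 : EuclideanSpace ℝ (Fin 3)) 1)) ^ (1 / 3 : ℝ) with hAP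
  set AV : ℝ := (∫ y in closedBall (0 : EuclideanSpace ℝ (Fin 3)) |R₀|, ‖V y‖ ^ 3) +
    Cup * ∫ z, ‖V z‖ ^ 2 with hAV
  have hAP0 : 0 ≤ AP := by positivity
  have hAV0 : 0 ≤ AV := add_nonneg (setIntegral_nonneg measurableSet_closedBall fun y _ => by positivity)
    (mul_nonneg hCup (integral_nonneg fun z => by positivity))
  have hPg : ∀ L : ℝ, 1 ≤ L → ∫ y in ball (0 : EuclideanSpace ℝ (Fin 3)) L, |P y| ≤
      max AP AV * L ^ (3 - (4 / 3 : ℝ)) := by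
    intro L hL
    rw [show (3 : ℝ) - 4 / 3 = 5 / 3 by norm_num]
    exact (setIntegral_abs_le_of_weight hPm hBne hPw hL).trans
      (mul_le_mul_of_nonneg_right (le_max_left _ _) (by positivity))
  have hVg : ∀ L : ℝ, 1 ≤ L → ∫ y in ball (0 : EuclideanSpace ℝ (Fin 3)) L, ‖V y‖ ^ 3 ≤
      max AP AV * L ^ (3 - (4 / 3 : ℝ)) := by
    intro L hL
    rw [show (3 : ℝ) - 4 / 3 = 5 / 3 by norm_num]
    exact (setIntegral_cube_le_of_sublinear hV2 hV3 hδ1 (by linarith) hCup hup hL).trans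
      (mul_le_mul_of_nonneg_right (le_max_right _ _) (by positivity))
  -- the Riesz representation at every scale
  have hPR : ∀ R : ℝ, 1 ≤ R → ∀ᵐ y ∂volume, ‖y‖ < R / 2 →
      P y = rieszPressure ((ball (0 : EuclideanSpace ℝ (Fin 3)) R).indicator V) y +
        ∫ z in {z | R ≤ ‖z‖}, pressureKernel (y - z) (V z) :=
    fun R hR => pressure_ae_eq_scaleQ_of_poisson hVm hV2 hV3 hP1 hPoisson (σ := 4 / 3)
      (by norm_num) (by norm_num) (le_max_of_le_left hAP0) hPg hVg (by linarith)
  exact selfSimilar_half_false_of_powerSpread hsw hH hgauge hu hp hPR hδ hδ1 hCup hup hc₀ hδ' hlow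

/-- **The power-spread stratum of rung C1 at the endpoint, `Sig.rungC1_selfSimilar`-shaped, with
the pressure formula derived from the class.** [cite: ChaeShvydkoy2013, §3.1 Thm. 3.1] -/
theorem selfSimilar_half_ae_eq_zero_of_powerSpread'
    {u : ℝ → EuclideanSpace ℝ (Fin 3) → EuclideanSpace ℝ (Fin 3)}
    {p : ℝ → EuclideanSpace ℝ (Fin 3) → ℝ}
    {H : ℝ → EuclideanSpace ℝ (Fin 3) → EuclideanSpace ℝ (Fin 3) →L[ℝ] EuclideanSpace ℝ (Fin 3)}
    {c : ℝ≥0} {V : EuclideanSpace ℝ (Fin 3) → EuclideanSpace ℝ (Fin 3)}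
    {P : EuclideanSpace ℝ (Fin 3) → ℝ}
    (hsw : IsSuitableWeakSolutionOn (slab (EuclideanSpace ℝ (Fin 3)) (Iio 0) isOpen_Iio) 0 0 u p)
    (hH : HasWeakSpatialGradientOn (slab (EuclideanSpace ℝ (Fin 3)) (Iio 0) isOpen_Iio) u H)
    (hgauge : ∀ a : ℝ, 0 < a →
      ENNReal.ofReal (a ^ (2 * (1 / 2 : ℝ))) * cknA a (0 : ℝ × EuclideanSpace ℝ (Fin 3)) u +
          ENNReal.ofReal (a ^ (1 / 2 : ℝ)) * cknE a (0 : ℝ × EuclideanSpace ℝ (Fin 3)) H +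
        ENNReal.ofReal (a ^ (2 * (1 / 2 : ℝ))) * cknD a (0 : ℝ × EuclideanSpace ℝ (Fin 3)) p ≤
          (c : ℝ≥0∞))
    (hu : ∀ τ : ℝ, τ < 0 → u τ = selfSimilarCollapse (1 / (2 + (1 / 2 : ℝ))) 0 V τ)
    (hp : ∀ τ : ℝ, τ < 0 → p τ = selfSimilarCollapsePressure (1 / (2 + (1 / 2 : ℝ))) 0 P τ)
    {δ Cup R₀ : ℝ} (hδ : 0 < δ) (hδ1 : δ ≤ 1) (hCup : 0 ≤ Cup)
    (hup : ∀ᵐ y ∂volume, R₀ ≤ ‖y‖ → ‖V y‖ ≤ Cup * ‖y‖ ^ (1 - δ))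
    {c₀ δ' R₀' : ℝ} (hc₀ : 0 < c₀) (hδ' : 0 < δ')
    (hlow : ∀ᵐ y ∂volume, R₀' ≤ ‖y‖ → c₀ * ‖y‖ ^ (-(4 - δ')) ≤ ‖V y‖) :
    uncurry u =ᵐ[volume.restrict (Iio (0 : ℝ) ×ˢ (univ : Set (EuclideanSpace ℝ (Fin 3))))] 0 :=
  (selfSimilar_half_false_of_powerSpread' hsw hH hgauge hu hp hδ hδ1 hCup hup hc₀ hδ' hlow).elim

end Member

end Summit.NavierStokesRegularity.NavierStokesRegularity.Theorems.PowerGaugeEulerLiouville
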